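import Summits.ResolutionOfSingularities.ResolutionOfSingularities.Theorems.TightDefectClasses
import Summits.ResolutionOfSingularities.ResolutionOfSingularities.Theorems.DeltaCutSep
import Summits.ResolutionOfSingularities.ResolutionOfSingularities.Theorems.HeightLaw
import Summits.ResolutionOfSingularities.ResolutionOfSingularities.Theorems.WeightedInvariantOrderHasseZariskiNagata
import Summits.ResolutionOfSingularities.ResolutionOfSingularities.Theorems.PurelyInseparableDim4SymbolicPower
import Literature.AlgebraicGeometry.Hironaka2017.Lib.SpecOrdersDiff
import Literature.AlgebraicGeometry.Hironaka2017.Lib.SInclCoordCentre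
import Literature.RingTheory.MvPolynomial.IdealOfVarsBasics
import Mathlib.RingTheory.Ideal.GoingUp
import Mathlib.RingTheory.Ideal.MinimalPrime.Noetherian
import Mathlib.RingTheory.AdjoinRoot
import Mathlib.RingTheory.MvPolynomial.Basic
import Mathlib.Data.Nat.Multiplicity
import HarnessLib

/-!
# IsoDict — decomp-res node «IsoDict» (lens-5 g33 rider «IsoDict», critic row 206; landing rider INBOX
2026-08-31T10:19:52Z), tree file 1/2 of the node

Content VERBATIM from the decomp-res lens-5 g33 rider «IsoDict» (to node «BandCut», row 205): `HOME/decomp-res-lens-5/g33/landing/IsoDict.lean` (sha256 9330831b, 516 l; byte-identical to `HOME/decomp-res-lens-5/g33/IsoDict.lean`; RIDER-IsoDict.md 3960f356, MAPPORT-RECON.md 1b7ffea0, bc/IsoProbe.lean 7a7b5d03 HOME-only); shas verified = PIN STATUS 2026-08-31T10:16:17Z = CRITIC-LEDGER row 206; HOME = run/shared/lean/pub/decomp-res.  Imports the LANDED tree only (`TightDefectClasses`, `DeltaCutSep`, `HeightLaw`, `WeightedInvariantOrderHasseZariskiNagata`, `PurelyInseparableDim4SymbolicPower`, Literature `Hironaka2017.Lib.SpecOrdersDiff`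 / `SInclCoordCentre` / `RingTheory.MvPolynomial.IdealOfVarsBasics`, Mathlib GoingUp / MinimalPrime.Noetherian / AdjoinRoot / MvPolynomial.Basic / Nat.Multiplicity, HarnessLib); NO carry; new namespace `…Theorems.IsoDict` (no tree file declared it before); every declaration is new.  Farm (lens + critic runs): rc 0 · 0 err · 0 sorry (only `linter.dupNamespace` warnings, as for every `…ResolutionOfSingularities.ResolutionOfSingularities…` tree file); `--axioms` = [propext, Classical.choice, Quot.sound] on `isIsolatedIn_topLocusOf_rootStage_iff_isolatedTop` (closure covers `isIsolatedIn_topLocus_origin_iff_isolatedTop`, `exists_prime_of_not_isolatedTop`, `exists_prime_over_le_idealOfVars`, `hypZ_mem_symbPow`, `eq_idealOfVars_of_mem_symbPow`, `hasseDeriv_hypZ_mem`); IsoProbe rc 0 (P1/P2 = proved vacuity witnesses: both truth values realised).  Critic: CRITIC-LEDGER row 206 «IsoDict» (window = row 205: the (T-bridge) is JOINT with lens-6 — «(iii) ALONE = 0 UNLESS delivered as the load-bearing lemma OF the joint (T-bridge) with lens-6 consuming it BY NAME — then it is the bridge's MAP +1, one payment, to the prover»); DESK (i) STATEMENT = MAPPORT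 spec (iii) VERBATIM and WHOLE — both directions, the level-0 chart point = the origin of `Spec K[z, u₁…uₙ]`, general `n` (E-model `_three`), binders exactly `[PerfectField K] [CharP K p] (hp : p.Prime) (e) (F : MvPolynomial (Fin n) K) (hF : p^e ≤ ord₀ F) [DecidableEq K]` — no isolation / root / walk / boundary / field-size binder; LETTERS ARE THE TREE'S: `ForcedTowerClasses.IsIsolatedIn` and `TightDefectClasses.IsolatedTop`; not a re-lettering (`topLocus` / `hypZ` / `rootStage` are support defs; `topLocusOf_rootStage : DeltaCutClasses.topLocusOf q (rootStage q F) = topLocus q F` is `rfl` into lens-6's own `topLocusOf`); (ii) MECHANISM genuine on both halves: (⇐) Zariski–Nagata `HironakaScheme.hasseDeriv_mem_symbPow` + the basic open `D(g)`; (⇒) a prime `𝔓 ∌ z·…` of the top locus through the origin other than `(z, u)` via going-up along `K[u] → K[z, u]/(z^q + F)` and minimal primes.  Landing = the critic's LANDING RIDER row 206 to the writer (INBOX 2026-08-31T10:19:52Z; 0-weight, NORMAL priority — lens-6 g29 will import it): `Theorems/IsoDict` := landing/IsoDict.lean, `--kind proof --supports stmt-ResolutionOfSingularities-31770`, dry-run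 first, no aside change, post LANDED with p<id>.  The `def … : Prop` declarations (``) are THIS rider's support predicates — none is a vendored fact.  Nothing here is progress on `ResolutionOfSingularities` (rung 0): a dictionary lemma for the MAP tower port; the column item 31770 is untouched.

The lens header, verbatim:

> # IsoDict — the ISOLATION DICTIONARY of the MAP-tower port (MAPPORT spec (iii); residual lens-5, g33 rider)
>
> Host route `MaxContactCut`, column item `stmt-ResolutionOfSingularities-31770` (`DefectWalksTerminateDeep`).
> The open port `TightDefectClasses.TowerDictionary` has to identify, chart by chart, the SCHEME-side letter
> "`x` is an ISOLATED point of the top locus `{y | ord_y (z^q + F) ≥ q}`" (`ForcedTowerClasses.IsIsolatedIn`, the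
> letter inside `DeltaCutRun2.BadThread` / `ThreadCutJunction.EventuallyNonIsolated`) with the E-MODEL letter
> `TightDefectClasses.IsolatedTop q F` (some `g`, `g(0) ≠ 0`, multiplies a power of every `u`-variable into the
> top-locus ideal `J_F = (D^{(d)} F : 0 < |d| < q)`).  This file proves that identification in the affine chart
> `Spec K[z, u₁, …, uₙ]` at the origin, for `K` perfect of characteristic `p` and `q = pᵉ`:
>
> * `isIsolatedIn_topLocus_origin_iff_isolatedTop` (THE DICTIONARY LEMMA):
>   `IsIsolatedIn {y | q ≤ ord_y (z^q + F)} origin ↔ IsolatedTop q F` whenever `ord₀ F ≥ q`;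
> * `isIsolatedIn_topLocus_origin_iff_isolatedTop_three`: the E-model instance `n = 3` (`Spec K[z, u₀, u₁, u₂]`);
> * `isIsolatedIn_topLocusOf_rootStage_iff_isolatedTop` (§6): the same sentence in lens-6's LITERAL letters
>   `DeltaCutClasses.topLocusOf q (rootStage q F)` (`DeltaCutRun.Stage = ⟨Y, I⟩`; the identification
>   `topLocusOf_rootStage` is `rfl`) — the (T-bridge) load-bearing lemma as its consumer
>   `badThread_pt_isolated_iff_isolatedTop` (lens-6 g29) cites it.
>
> Mechanism.  `q ≤ ord_𝔓 (z^q + F)` iff `z^q + F ∈ 𝔓^{(q)}` (symbolic power; `SpecOrders`).  (⇐) The easy half of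
> Zariski–Nagata (`HironakaScheme.hasseDeriv_mem_symbPow`) puts `J_F · K[z,u]` inside every such `𝔓`; on the basic
> open `D(g)` this forces `u ⊆ 𝔓`, then `F ∈ 𝔓`, `z^q ∈ 𝔓`, `𝔓 = (z, u)`.  (⇒) If the origin is NOT E-isolated, a
> prime `J_F ⊆ 𝔭 ⊊ (u)` of `K[u]` exists (Noetherian: finitely many minimal primes, prime avoidance of a product);
> GOING-UP along the integral extension `K[u] → K[z,u]/(z^q + F)` (`AdjoinRoot`, monic) lifts it to a prime
> `𝔓 ⊊ (z, u)` containing `z^q + F` and `J_F`; the HARD half of Zariski–Nagata for perfect `K`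
> (`exists_mul_mem_pow_iff_forall_hasseDeriv_mem`) together with `D^{(k e_z)} z^{pᵉ} = C(pᵉ,k) z^{pᵉ-k} ≡ 0 (mod p)`
> for `0 < k < pᵉ` shows `z^q + F ∈ 𝔓^{(q)}`, i.e. `𝔓` is a proper generization of the origin INSIDE the top locus,
> so the origin is not Zariski-isolated in it.
>
> Everything is stated for a general number `n` of `u`-variables (`z = X 0`, `uᵢ = X i.succ`, the `PIDim4.hyp`
> convention); the E-model uses `n = 3`.

## This file

§1 the hypersurface `hypZ q F = z^q + F(u)` in `K[z, u₁, …, uₙ]` and its Hasse–Schmidt derivatives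
(`hasseDeriv_hypZ_mem`, …); §2 the easy half — where `z^q + F` is symbolically `q`-fold, `J_F` vanishes
(`hypZ_mem_symbPow`, `eq_idealOfVars_of_mem_symbPow`); §3 the E-model side: `IsolatedTop` as a statement about
primes (`exists_prime_of_not_isolatedTop`); §4 going-up along `K[u] → K[z, u]/(z^q + F)`
(`exists_prime_over_le_idealOfVars`); §5 the scheme side: `topLocus` on `Spec K[z, u]` and THE DICTIONARY
**`isIsolatedIn_topLocus_origin_iff_isolatedTop`**; §6 lens-6's literal currency: the affine root stage `rootStage`,
`topLocusOf_rootStage` (`rfl`), **`isIsolatedIn_topLocusOf_rootStage_iff_isolatedTop`**.  (The 400-line cap cuts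
this group into 2 files; this first part carries: `hypZ`, `rename_succ_mem_supported`, `X_zero_pow_mem_supported`,
`hasseDeriv_mapDomain_hypZ`, `hasseDeriv_hypZ_eq_zero_of_mixed`, `hasseDeriv_single_zero_hypZ`, `eq_mapDomain_tail`,
`hasseDeriv_hypZ_mem`, `hypZ_mem_symbPow`, `map_topIdeal_le_of_hypZ_mem_symbPow`, `eq_idealOfVars_of_mem_symbPow`,
`hypZ_mem_idealOfVars_pow`, `exists_prime_of_not_isolatedTop`, `comap_rename_succ_idealOfVars`.)

[WRITER NOTE (decomp-res writer g13): file split only — the landing file is 516 lines, over the tree's 400-line cap,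
and has a single root namespace with no inner sections before §6, so it is cut by the cap between two declarations:
`IsoDict` (part 1) and `IsoDict2` (part 2, imports part 1; `section RootStage` = §6 whole in part 2); the file-level
`set_option autoImplicit false`, `noncomputable section` and `open … (…)` lines and the namespace-level `variable {K
: Type} [Field K] {n : ℕ}` are replayed in part 2; every declaration, docstring and `/-! ## §k -/` comment exactly
as in the landing file (each § comment travels with its first declaration).  CONSUMERS (lens-6 g29): import
`…Theorems.IsoDict2` to have the whole dictionary incl. `isIsolatedIn_topLocusOf_rootStage_iff_isolatedTop` in
scope.  No dedup deletions (pre-flight clean).]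

(Sources: Hironaka1964 Ch. III §3 (Zariski–Nagata via Hasse–Schmidt derivations); CossartJannsenSaito2020 Ch. 2
(Hironaka schemes, directrix); Hauser2010 §§C–D; CutkoskyResolutionBook2004 §7.)
-/

set_option autoImplicit false

noncomputable section

open MvPolynomial AlgebraicGeometry
open Literature.AlgebraicGeometry.Resolution (hasseDeriv hasseDeriv_X_pow hasseDeriv_eq_zero_of_mem_supported
  hasseDeriv_zero_apply idealOrder)
open Literature.AlgebraicGeometry.Resolution.Hauser2010 (ordZero natCast_le_ordZero_iff_forall_coeff)
open Literature.AlgebraicGeometry.Resolution.HironakaScheme (symbPow mem_symbPow_of_mem_pow hasseDeriv_mem_symbPow)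
open Literature.AlgebraicGeometry.Hironaka2017.SpecOrders (Zs shf le_idealOrder_shf_span_singleton_iff)
open Literature.AlgebraicGeometry.Hironaka2017.S02Preliminaries.CoordChart (origin isMaximal_idealOfVars)
open Literature.RingTheory.MvPolynomial (mem_idealOfVars_iff_constantCoeff_eq_zero X_mem_idealOfVars
  idealOfVars_ne_top)
open Summit.ResolutionOfSingularities.ResolutionOfSingularities.Theorems.ForcedTowerClasses (IsIsolatedIn)
open Summit.ResolutionOfSingularities.ResolutionOfSingularities.Theorems.TightDefectClasses (topIdeal IsolatedTop)
open Summit.ResolutionOfSingularities.ResolutionOfSingularities.Theorems.PIDim4.SymbolicPower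
  (hasseDeriv_mapDomain_rename mem_of_mem_symbPow)

namespace Summit.ResolutionOfSingularities.ResolutionOfSingularities.Theorems.IsoDict

variable {K : Type} [Field K] {n : ℕ}

/-! ## §1 The hypersurface `z^q + F(u)` in `K[z, u₁, …, uₙ]` and its Hasse–Schmidt derivatives -/

/-- `z^q + F(u₁, …, uₙ)` read in `K[z, u]` (`z = X 0`, `uᵢ = X i.succ`). DEFINITION (support). [folklore] -/
def hypZ (q : ℕ) (F : MvPolynomial (Fin n) K) : MvPolynomial (Fin (n + 1)) K :=
  X 0 ^ q + rename Fin.succ F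

/-- `F(u)`, read in `K[z, u]`, does not involve `z`. OURS (bookkeeping). [folklore] -/
theorem rename_succ_mem_supported (F : MvPolynomial (Fin n) K) :
    rename Fin.succ F ∈ supported K (({0} : Set (Fin (n + 1)))ᶜ) := by
  classical
  rw [mem_supported]
  intro i hi
  obtain ⟨j, -, rfl⟩ := Finset.mem_image.mp (vars_rename Fin.succ F hi)
  simp [Fin.succ_ne_zero]

/-- `z^q` involves only `z`. OURS (bookkeeping). [folklore] -/
theorem X_zero_pow_mem_supported (q : ℕ) :
    (X 0 ^ q : MvPolynomial (Fin (n + 1)) K) ∈ supported K ({0} : Set (Fin (n + 1))) :=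
  pow_mem (X_mem_supported.mpr (Set.mem_singleton (0 : Fin (n + 1)))) q

/-- `D^{(α)}(z^q + F) = D^{(α)} F` for `α ≠ 0` in the `u`-directions. (Sources: EGAIV4, Thm. 16.11.2 ((16.11.2.1)).) -/
theorem hasseDeriv_mapDomain_hypZ (q : ℕ) (F : MvPolynomial (Fin n) K) {α : Fin n →₀ ℕ} (hα : α ≠ 0) :
    hasseDeriv K (α.mapDomain Fin.succ) (hypZ q F) = rename Fin.succ (hasseDeriv K α F) := by
  classical
  obtain ⟨i, hi⟩ : ∃ i, α i ≠ 0 := by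
    by_contra h
    exact hα (Finsupp.ext fun i => by
      by_contra h'
      exact h ⟨i, h'⟩)
  rw [hypZ, map_add, hasseDeriv_mapDomain_rename (Fin.succ_injective n),
    hasseDeriv_eq_zero_of_mem_supported K (X_zero_pow_mem_supported q) (i := i.succ)
      (by simp [Fin.succ_ne_zero]) (by rwa [Finsupp.mapDomain_apply (Fin.succ_injective n)]), zero_add]

/-- A MIXED derivative (positive `z`-order and positive order in some `uᵢ`) kills `z^q + F`. [folklore] -/
theorem hasseDeriv_hypZ_eq_zero_of_mixed (q : ℕ) (F : MvPolynomial (Fin n) K) {β : Fin (n + 1) →₀ ℕ}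
    (h0 : β 0 ≠ 0) {i : Fin n} (hi : β i.succ ≠ 0) : hasseDeriv K β (hypZ q F) = 0 := by
  classical
  rw [hypZ, map_add,
    hasseDeriv_eq_zero_of_mem_supported K (X_zero_pow_mem_supported q) (i := i.succ)
      (by simp [Fin.succ_ne_zero]) hi,
    hasseDeriv_eq_zero_of_mem_supported K (rename_succ_mem_supported F) (i := 0) (by simp) h0, add_zero]

/-- **The characteristic-`p` input**: `D^{(k e_z)}(z^{pᵉ} + F) = C(pᵉ, k) z^{pᵉ - k} = 0` for `0 < k < pᵉ`
(`p ∣ C(pᵉ, k)`, Kummer). (Sources: EGAIV4, Thm. 16.11.2 ((16.11.2.1)).) -/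
theorem hasseDeriv_single_zero_hypZ {p : ℕ} (hp : p.Prime) [CharP K p] (e : ℕ) (F : MvPolynomial (Fin n) K)
    {k : ℕ} (hk0 : k ≠ 0) (hkq : k < p ^ e) :
    hasseDeriv K (Finsupp.single 0 k) (hypZ (p ^ e) F) = 0 := by
  classical
  have hchoose : ((p ^ e).choose k : MvPolynomial (Fin (n + 1)) K) = 0 := by
    rw [CharP.cast_eq_zero_iff (MvPolynomial (Fin (n + 1)) K) p]
    exact hp.dvd_choose_pow_iff.mpr ⟨hk0, hkq.ne⟩
  rw [hypZ, map_add, hasseDeriv_X_pow, hchoose, zero_mul, zero_add]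
  exact hasseDeriv_eq_zero_of_mem_supported K (rename_succ_mem_supported F) (i := 0) (by simp)
    (by rw [Finsupp.single_eq_same]; exact hk0)

/-- A multi-index with no `z`-component is a `u`-multi-index. OURS (bookkeeping). [folklore] -/
theorem eq_mapDomain_tail {β : Fin (n + 1) →₀ ℕ} (h0 : β 0 = 0) :
    β = (Finsupp.tail β).mapDomain Fin.succ := by
  ext i
  refine Fin.cases ?_ (fun j => ?_) i
  · rw [h0, Finsupp.mapDomain_notin_range]
    rintro ⟨j, hj⟩
    exact Fin.succ_ne_zero j hj
  · rw [Finsupp.mapDomain_apply (Fin.succ_injective n), Finsupp.tail_apply]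

/-- **All Hasse derivatives of order `< pᵉ` of `z^{pᵉ} + F` lie in any ideal containing `z^{pᵉ} + F` and
`J_F · K[z, u]`** (the four cases: `β = 0`; pure `u`; mixed; pure `z` — the last by characteristic `p`). (Sources:
EGAIV4, Thm. 16.11.2 ((16.11.2.1)).) -/
theorem hasseDeriv_hypZ_mem [DecidableEq K] {p : ℕ} (hp : p.Prime) [CharP K p] (e : ℕ)
    (F : MvPolynomial (Fin n) K) {𝔓 : Ideal (MvPolynomial (Fin (n + 1)) K)} (hP : hypZ (p ^ e) F ∈ 𝔓)
    (hJ : (topIdeal (p ^ e) F).map (rename Fin.succ) ≤ 𝔓) (β : Fin (n + 1) →₀ ℕ)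
    (hβ : β.degree < p ^ e) : hasseDeriv K β (hypZ (p ^ e) F) ∈ 𝔓 := by
  classical
  by_cases hβ0 : β = 0
  · subst hβ0
    rwa [hasseDeriv_zero_apply]
  by_cases hsucc : ∃ i : Fin n, β i.succ ≠ 0
  · obtain ⟨i, hi⟩ := hsucc
    by_cases hz : β 0 = 0
    · have htail : Finsupp.tail β ≠ 0 := by
        intro ht
        apply hi
        rw [← Finsupp.tail_apply, ht, Finsupp.coe_zero, Pi.zero_apply]
      have hdeg : (Finsupp.tail β).degree < p ^ e := by
        have h := hβ
        rw [eq_mapDomain_tail hz, Finsupp.degree_mapDomain] at h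
        exact h
      rw [eq_mapDomain_tail hz, hasseDeriv_mapDomain_hypZ _ _ htail]
      exact hJ (Ideal.mem_map_of_mem _ (Ideal.subset_span ⟨Finsupp.tail β, ⟨htail, hdeg⟩, rfl⟩))
    · rw [hasseDeriv_hypZ_eq_zero_of_mixed _ _ hz hi]
      exact 𝔓.zero_mem
  · have hβeq : β = Finsupp.single 0 (β 0) := by
      ext i
      refine Fin.cases ?_ (fun j => ?_) i
      · rw [Finsupp.single_eq_same]
      · rw [Finsupp.single_apply, if_neg (Fin.succ_ne_zero j).symm]
        by_contra h
        exact hsucc ⟨j, h⟩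
    have hk0 : β 0 ≠ 0 := by
      intro h
      apply hβ0
      rw [hβeq, h, Finsupp.single_zero]
    have hdeg : β.degree = β 0 := by
      conv_lhs => rw [hβeq]
      exact Finsupp.degree_single _ _
    have hkq : β 0 < p ^ e := hdeg ▸ hβ
    rw [hβeq, hasseDeriv_single_zero_hypZ hp e F hk0 hkq]
    exact 𝔓.zero_mem

/-- **`z^{pᵉ} + F ∈ 𝔓^{(pᵉ)}` at every prime `𝔓 ∋ z^{pᵉ} + F` containing `J_F`** (`K` perfect: the hard half of
Zariski–Nagata with Hasse–Schmidt derivatives). (Sources: EGAIV4, Thm. 16.11.2; Matsumura1987, §6 / Thm. 4.1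
(symbolic powers).) -/
theorem hypZ_mem_symbPow [DecidableEq K] [PerfectField K] {p : ℕ} (hp : p.Prime) [CharP K p] (e : ℕ)
    (F : MvPolynomial (Fin n) K) {𝔓 : Ideal (MvPolynomial (Fin (n + 1)) K)} [𝔓.IsPrime]
    (hP : hypZ (p ^ e) F ∈ 𝔓) (hJ : (topIdeal (p ^ e) F).map (rename Fin.succ) ≤ 𝔓) :
    hypZ (p ^ e) F ∈ symbPow K 𝔓 (p ^ e) :=
  (exists_mul_mem_pow_iff_forall_hasseDeriv_mem K 𝔓 (p ^ e) (hypZ (p ^ e) F)).mpr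
    (fun β hβ => hasseDeriv_hypZ_mem hp e F hP hJ β hβ)

/-! ## §2 The easy half: where `z^q + F` is symbolically `q`-fold, `J_F` vanishes -/

/-- **`J_F · K[z, u] ⊆ 𝔓` whenever `z^q + F ∈ 𝔓^{(q)}`** (`D^{(α)}(𝔓^{(q)}) ⊆ 𝔓^{(q-|α|)} ⊆ 𝔓` for `|α| < q`,
and `D^{(α)}(z^q + F) = D^{(α)} F` in the `u`-directions). (Sources: Dietel2015, Lemma (9.1.4) p. 108.) -/
theorem map_topIdeal_le_of_hypZ_mem_symbPow [DecidableEq K] {q : ℕ} (F : MvPolynomial (Fin n) K)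
    {𝔓 : Ideal (MvPolynomial (Fin (n + 1)) K)} [𝔓.IsPrime] (h : hypZ q F ∈ symbPow K 𝔓 q) :
    (topIdeal q F).map (rename Fin.succ) ≤ 𝔓 := by
  classical
  rw [topIdeal, Ideal.map_span, Ideal.span_le]
  rintro _ ⟨_, ⟨d, ⟨hd0, hdq⟩, rfl⟩, rfl⟩
  rw [SetLike.mem_coe]
  have h1 := hasseDeriv_mem_symbPow h (d.mapDomain Fin.succ)
  rw [Finsupp.degree_mapDomain, hasseDeriv_mapDomain_hypZ q F hd0] at h1
  exact mem_of_mem_symbPow (by omega) h1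

/-- **ISOLATION ⇒ ONLY THE ORIGIN**: if `g(0) ≠ 0` multiplies a power of every `uᵢ` into `J_F` (`IsolatedTop`) and
`F(0) = 0`, then a prime `𝔓` of `K[z, u]` with `z^q + F ∈ 𝔓^{(q)}` (`q ≠ 0`) and `g ∉ 𝔓` IS the origin `(z, u)`.
(Sources: Dietel2015, Lemma (9.1.4) p. 108; Matsumura1987, §6 / Thm. 4.1 (symbolic powers).) -/
theorem eq_idealOfVars_of_mem_symbPow [DecidableEq K] {q : ℕ} (hq : q ≠ 0) {F : MvPolynomial (Fin n) K}
    (hF0 : constantCoeff F = 0) {N : ℕ} {g : MvPolynomial (Fin n) K} (hg : ∀ i, g * X i ^ N ∈ topIdeal q F)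
    {𝔓 : Ideal (MvPolynomial (Fin (n + 1)) K)} [h𝔓 : 𝔓.IsPrime] (hg𝔓 : rename Fin.succ g ∉ 𝔓)
    (h : hypZ q F ∈ symbPow K 𝔓 q) : 𝔓 = MvPolynomial.idealOfVars (Fin (n + 1)) K := by
  classical
  have hJ := map_topIdeal_le_of_hypZ_mem_symbPow F h
  have hu : ∀ i : Fin n, (X i.succ : MvPolynomial (Fin (n + 1)) K) ∈ 𝔓 := by
    intro i
    have h1 : rename Fin.succ (g * X i ^ N) ∈ 𝔓 := hJ (Ideal.mem_map_of_mem _ (hg i))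
    rw [map_mul, map_pow, rename_X] at h1
    exact h𝔓.mem_of_pow_mem N ((h𝔓.mem_or_mem h1).resolve_left hg𝔓)
  have hFmem : rename Fin.succ F ∈ 𝔓 := by
    have hFm : F ∈ MvPolynomial.idealOfVars (Fin n) K := by
      rwa [mem_idealOfVars_iff_constantCoeff_eq_zero]
    have hmap : (MvPolynomial.idealOfVars (Fin n) K).map (rename Fin.succ) ≤ 𝔓 := by
      rw [MvPolynomial.idealOfVars, Ideal.map_span, Ideal.span_le]
      rintro _ ⟨_, ⟨i, rfl⟩, rfl⟩
      rw [SetLike.mem_coe, rename_X]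
      exact hu i
    exact hmap (Ideal.mem_map_of_mem _ hFm)
  have hz : (X 0 : MvPolynomial (Fin (n + 1)) K) ∈ 𝔓 := by
    have hP : hypZ q F ∈ 𝔓 := mem_of_mem_symbPow hq h
    have h' := sub_mem hP hFmem
    rw [hypZ, add_sub_cancel_right] at h'
    exact h𝔓.mem_of_pow_mem q h'
  refine ((isMaximal_idealOfVars (k := K) (σ := Fin (n + 1))).eq_of_le h𝔓.ne_top ?_).symm
  rw [MvPolynomial.idealOfVars, Ideal.span_le]
  rintro _ ⟨i, rfl⟩
  rw [SetLike.mem_coe]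
  exact Fin.cases hz (fun j => hu j) i

/-- `z^q + F ∈ (z, u)^q` when `ord₀ F ≥ q`. (Sources: ZariskiSamuel1960, Vol. II Ch. VII §1 p.129 (order).) -/
theorem hypZ_mem_idealOfVars_pow {q : ℕ} {F : MvPolynomial (Fin n) K} (hF : (q : ℕ∞) ≤ ordZero F) :
    hypZ q F ∈ MvPolynomial.idealOfVars (Fin (n + 1)) K ^ q := by
  classical
  refine add_mem (Ideal.pow_mem_pow (X_mem_idealOfVars 0) q) ?_
  rw [natCast_le_ordZero_iff_forall_coeff] at hF
  rw [MvPolynomial.mem_pow_idealOfVars_iff']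
  intro d hd
  by_contra hne
  obtain ⟨u, rfl⟩ : ∃ u : Fin n →₀ ℕ, u.mapDomain Fin.succ = d := by
    by_contra hu
    exact hne (coeff_rename_eq_zero _ _ _ fun u h => (hu ⟨u, h⟩).elim)
  rw [coeff_rename_mapDomain _ (Fin.succ_injective n)] at hne
  rw [Finsupp.degree_mapDomain] at hd
  exact hne (hF u hd)

/-! ## §3 The E-model side: `IsolatedTop` as a statement about primes -/

/-- **PRIME FORM OF NON-ISOLATION**: if `J_F ⊆ (u)` and the origin is NOT an isolated point of `V(J_F)` in the
E-model sense (`¬ IsolatedTop`), some prime `J_F ⊆ 𝔭 ⊊ (u)` exists.  (Contrapositive: if `(u)` is the only prime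
between `J_F` and `(u)`, it is a minimal prime of `J_F`; a product `g` of elements of the other — finitely many,
Noetherian — minimal primes taken outside `(u)` has `g·uᵢ ∈ ⋂ Min(J_F) = √J_F`.) (Sources: AtiyahMacdonald1969, Ch.
1, Ex. 18; Matsumura1987, §6 / Thm. 4.1 (symbolic powers).) -/
theorem exists_prime_of_not_isolatedTop [DecidableEq K] {q : ℕ} {F : MvPolynomial (Fin n) K}
    (h : ¬ IsolatedTop q F) :
    ∃ 𝔭 : Ideal (MvPolynomial (Fin n) K), 𝔭.IsPrime ∧ topIdeal q F ≤ 𝔭 ∧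
      𝔭 ≤ MvPolynomial.idealOfVars (Fin n) K ∧ 𝔭 ≠ MvPolynomial.idealOfVars (Fin n) K := by
  classical
  by_contra hcon
  have hall : ∀ 𝔭 : Ideal (MvPolynomial (Fin n) K), 𝔭.IsPrime → topIdeal q F ≤ 𝔭 →
      𝔭 ≤ MvPolynomial.idealOfVars (Fin n) K → 𝔭 = MvPolynomial.idealOfVars (Fin n) K := by
    intro 𝔭 h1 h2 h3
    by_contra h4
    exact hcon ⟨𝔭, h1, h2, h3, h4⟩
  apply h
  have hmmax : (MvPolynomial.idealOfVars (Fin n) K).IsMaximal := isMaximal_idealOfVars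
  haveI : (MvPolynomial.idealOfVars (Fin n) K).IsPrime := hmmax.isPrime
  have hfin : (topIdeal q F).minimalPrimes.Finite :=
    Ideal.finite_minimalPrimes_of_isNoetherianRing (MvPolynomial (Fin n) K) (topIdeal q F)
  have hout : ∀ 𝔮 ∈ (topIdeal q F).minimalPrimes, 𝔮 ≠ MvPolynomial.idealOfVars (Fin n) K →
      ∃ t ∈ 𝔮, t ∉ MvPolynomial.idealOfVars (Fin n) K := by
    intro 𝔮 h𝔮 hne
    by_contra hno
    have hle : 𝔮 ≤ MvPolynomial.idealOfVars (Fin n) K := fun t ht => by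
      by_contra htm
      exact hno ⟨t, ht, htm⟩
    exact hne (hall 𝔮 h𝔮.1.1 h𝔮.1.2 hle)
  choose! t ht using hout
  set s : Finset (Ideal (MvPolynomial (Fin n) K)) := hfin.toFinset.erase (MvPolynomial.idealOfVars (Fin n) K)
    with hs
  set g : MvPolynomial (Fin n) K := ∏ 𝔮 ∈ s, t 𝔮 with hgdef
  have hgm : g ∉ MvPolynomial.idealOfVars (Fin n) K := by
    refine Finset.prod_induction t (fun x => x ∉ MvPolynomial.idealOfVars (Fin n) K)
      (fun a b ha hb hab => ?_) ?_ ?_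
    · exact ((‹(MvPolynomial.idealOfVars (Fin n) K).IsPrime›).mem_or_mem hab).elim ha hb
    · exact fun h1 => hmmax.ne_top ((Ideal.eq_top_iff_one _).mpr h1)
    · intro 𝔮 h𝔮
      obtain ⟨h𝔮m, h𝔮min⟩ := Finset.mem_erase.mp h𝔮
      exact (ht 𝔮 (hfin.mem_toFinset.mp h𝔮min) h𝔮m).2
  have hgX : ∀ i : Fin n, g * X i ∈ (topIdeal q F).radical := by
    intro i
    rw [← Ideal.sInf_minimalPrimes, Ideal.mem_sInf]
    intro 𝔮 h𝔮
    by_cases h𝔮m : 𝔮 = MvPolynomial.idealOfVars (Fin n) K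
    · rw [h𝔮m]
      exact Ideal.mul_mem_left _ _ (X_mem_idealOfVars i)
    · have htq : t 𝔮 ∈ 𝔮 := (ht 𝔮 h𝔮 h𝔮m).1
      obtain ⟨c, hc⟩ : t 𝔮 ∣ g :=
        Finset.dvd_prod_of_mem t (Finset.mem_erase.mpr ⟨h𝔮m, hfin.mem_toFinset.mpr h𝔮⟩)
      rw [hc, mul_assoc]
      exact Ideal.mul_mem_right _ _ htq
  choose N hN using fun i => Ideal.mem_radical_iff.mp (hgX i)
  refine ⟨Finset.univ.sup N, g ^ Finset.univ.sup N, ?_, fun i => ?_⟩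
  · rw [map_pow]
    refine pow_ne_zero _ ?_
    rwa [Ne, ← mem_idealOfVars_iff_constantCoeff_eq_zero]
  · rw [← mul_pow]
    exact Ideal.pow_mem_of_pow_mem _ (hN i) (Finset.le_sup (Finset.mem_univ i))

/-- `(rename succ)⁻¹ (z, u) = (u)` (constant coefficients are unchanged by renaming). OURS (bookkeeping). [folklore] -/
theorem comap_rename_succ_idealOfVars :
    (MvPolynomial.idealOfVars (Fin (n + 1)) K).comap (rename Fin.succ) = MvPolynomial.idealOfVars (Fin n) K := by
  ext G
  rw [Ideal.mem_comap, mem_idealOfVars_iff_constantCoeff_eq_zero, mem_idealOfVars_iff_constantCoeff_eq_zero,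
    constantCoeff_rename]

end Summit.ResolutionOfSingularities.ResolutionOfSingularities.Theorems.IsoDict
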